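import Summits.CriticalPhenomena.CardyFormulaZ2.Theorems.CardyComplexConeEdgePrecompactUFRSJunctionFunnelTwoData
import Summits.CriticalPhenomena.CardyFormulaZ2.Theorems.CardyComplexConeEdgePrecompactUFRSJunctionFunnelFrameChoice
import Summits.CriticalPhenomena.CardyFormulaZ2.Theorems.CardyComplexConeEdgePrecompactUFRSJunctionFunnelGateRead

/-!
# The junction funnel, part K: numerics of the scales, distances versus lattice coordinates
(line `qkz-strip-boundary-arm` of crux `CardyComplexCone.EdgePrecompact`, stmt-CriticalPhenomena-11387;
eleventh file of the registered sub-goal S2 = `ufrs_junctionFunnel`, lead c5, wave 4; registered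
anchor `numerics_JF`)

* `far_lattice_JF`, `dist_corner_le_JF`, `abs_le_floor_JF` — conversions between Euclidean
  distances of mesh points and sup-distances of lattice points (after `…UFRSRectArcNear.lean`);
* `numerics_JF` (registered anchor) — with `t = r/δ ≥ 64`, `K ≥ 16`, `Kη ≤ r`, `2N₀δ ≤ r`: the
  near threshold `ν₀ = ⌊(r/K + η + 2δ)/δ⌋ + 3`, the far threshold `Lf = ⌊(Kr - η)/(2δ)⌋ - 4`, the
  gate scale `N = ⌊r/(2δ)⌋ + ν₀ + 4 ≥ N₀` and depth `h = ⌊η/δ⌋ + 2 ≤ N`, the inner radius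
  `⌊r/δ⌋ + 1` and the outer thresholds satisfy the linear inequalities consumed by
  `junction_main_JF`;
* `medialPoint_shift_JF`, `fin4_frame_index_JF`, `frame_abs_JF` — small bookkeeping.

References: folklore.
-/

set_option linter.unusedVariables false

namespace Summit.CriticalPhenomena.CardyFormulaZ2.Cruxes.EdgePrecompact.QkzStripBoundaryArm

open MeasureTheory Filter Set Metric
open scoped Topology BigOperators Pointwise
open Literature.Probability.LatticeModels Literature.Probability.Percolation
open Literature.Probability.RandomPlanarGeometry (DobrushinDomain)
open Summit.CriticalPhenomena.CardyFormulaZ2.Theses.CardyComplexCone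

noncomputable section

/-! ## Numerics of the scales and conversions between distances and lattice coordinates -/

/-- **Far points in lattice terms**: if `dist (δ v, z) ≥ D` and `2δ(L + 1) < D` then `v` is at
sup-distance `≥ L + 1` from the lattice point below `z`. -/
theorem far_lattice_JF {δ D : ℝ} (hδ : 0 < δ) {v : Site 2} {z : ℂ} (h : D ≤ dist (meshPoint δ v) z) (L : ℤ)
    (hL : 2 * (δ * (L + 1)) < D) :
    (L + 1 ≤ v 0 - ⌊z.re / δ⌋ ∨ L + 1 ≤ ⌊z.re / δ⌋ - v 0) ∨ (L + 1 ≤ v 1 - ⌊z.im / δ⌋ ∨ L + 1 ≤ ⌊z.im / δ⌋ - v 1) := by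
  by_contra hcon
  have h1 : v 0 - ⌊z.re / δ⌋ ≤ L ∧ ⌊z.re / δ⌋ - v 0 ≤ L := by constructor <;> omega
  have h2 : v 1 - ⌊z.im / δ⌋ ≤ L ∧ ⌊z.im / δ⌋ - v 1 ≤ L := by constructor <;> omega
  have := dist_le_of_latticeSup_le_HJ hδ h1 h2
  linarith

/-- A corner of the rectangle is within `2δ` of the corresponding corner of the lattice box. -/
theorem dist_corner_le_JF {δ : ℝ} (hδ : 0 < δ) (q : ℂ) (c : Site 2) (h0 : |q.re - δ * c 0| ≤ δ) (h1 : |q.im - δ * c 1| ≤ δ) :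
    dist q (meshPoint δ c) ≤ 2 * δ := by
  rw [Complex.dist_eq]
  refine (Complex.norm_le_abs_re_add_abs_im _).trans ?_
  rw [Complex.sub_re, Complex.sub_im, meshPoint_re, meshPoint_im]
  linarith

/-- The integer scales of the funnel and their inequalities. With `t = r/δ ≥ 64`, `K ≥ 16`,
`Kη ≤ r`: the near threshold `ν₀ = ⌊(r/K + η + 2δ)/δ⌋ + 3`, the far threshold
`Lf = ⌊(Kr - η)/(2δ)⌋ - 4`, the gate scale `N = ⌊r/(2δ)⌋ + ν₀ + 4` and depth `h = ⌊η/δ⌋ + 2`, the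
inner radius `⌊r/δ⌋ + 1`, the outer thresholds `⌊Kr/(2δ)⌋ - 2`, `⌊(Kr - δ)/(2δ)⌋ - 2`. -/
theorem numerics_JF : ∀ (δ r K η : ℝ) (N₀ : ℕ), 0 < δ → 16 ≤ K → K * η ≤ r → 64 * δ ≤ r → 0 ≤ η → 2 * (N₀ : ℝ) * δ ≤ r → 0 ≤ ⌊(r / K + η + 2 * δ) / δ⌋ + 1 ∧ 2 * (⌊(r / K + η + 2 * δ) / δ⌋ + 3) + 6 ≤ ⌊(K * r - η) / (2 * δ)⌋ - 4 ∧ (N₀ : ℤ) ≤ ⌊r / (2 * δ)⌋ + (⌊(r / K + η + 2 * δ) / δ⌋ + 3) + 4 ∧ 0 ≤ ⌊η / δ⌋ ∧ 2 * (⌊η / δ⌋ + 2) + 2 ≤ ⌊r / (2 * δ)⌋ + (⌊(r / K + η + 2 * δ) / δ⌋ + 3) + 4 ∧ 4 * (⌊r / (2 * δ)⌋ + (⌊(r / K + η + 2 * δ) / δ⌋ + 3) + 4) + 2 * (⌊η / δ⌋ + 2) + 4 ≤ ⌊(K * r - η) / (2 * δ)⌋ - 4 - (⌊(r / K + η + 2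 * δ) / δ⌋ + 3) - 2 ∧ ⌊r / δ⌋ + 1 + (⌊(r / K + η + 2 * δ) / δ⌋ + 3) + 2 ≤ 2 * (⌊r / (2 * δ)⌋ + (⌊(r / K + η + 2 * δ) / δ⌋ + 3) + 4) - 1 ∧ 4 * (⌊r / (2 * δ)⌋ + (⌊(r / K + η + 2 * δ) / δ⌋ + 3) + 4) + (⌊η / δ⌋ + 2) + 3 ≤ ⌊K * r / (2 * δ)⌋ - 2 + 1 - (⌊(r / K + η + 2 * δ) / δ⌋ + 3) - 2 ∧ 4 * (⌊r / (2 * δ)⌋ + (⌊(r / K + η + 2 * δ) / δ⌋ + 3) + 4) + 2 * (⌊η / δ⌋ + 2) + 2 ≤ ⌊(K * r - δ) / (2 * δ)⌋ - 2 + 1 - (⌊(r / K + η + 2 * δ) / δ⌋ + 3) - 2 ∧ 2 * (δ * ((⌊(K * r - η) / (2 * δ)⌋ - 4 : ℤ) + 2 + 1)) < K * r - η ∧ 2 * (δ * ((⌊K * r / (2 * δ)⌋ - 2 : ℤ) + 1)) < K * r ∧ 2 * (δ * ((⌊(K * r - δ) / (2 * δ)⌋ - 2 : ℤ) + 1)) <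 K * r - δ := by
  intro δ r K η N₀ hδ hK hKη h64 hη hN₀
  have hK0 : 0 < K := by linarith
  have hr0 : 0 < r := by linarith [mul_pos (by norm_num : (0:ℝ) < 64) hδ]
  set t := r / δ with ht
  set e := η / δ with he
  set q := r / (K * δ) with hq
  set Kt := K * r / δ with hKt
  have ht64 : 64 ≤ t := by rw [ht, le_div_iff₀ hδ]; linarith
  have he0 : 0 ≤ e := div_nonneg hη hδ.le
  have heK : K * e ≤ t := by rw [he, ht, mul_div_assoc', div_le_div_iff_of_pos_right hδ]; exact hKη
  have het : 16 * e ≤ t := le_trans (by nlinarith) heK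
  have hq0 : 0 ≤ q := by positivity
  have hqt : 16 * q ≤ t := by
    rw [hq, ht, mul_div_assoc', div_le_div_iff₀ (by positivity) hδ]
    have h' : 0 ≤ r * δ * (K - 16) := mul_nonneg (mul_nonneg hr0.le hδ.le) (by linarith)
    nlinarith [h']
  have hKt16 : 16 * t ≤ Kt := by
    rw [hKt, ht, mul_div_assoc', div_le_div_iff_of_pos_right hδ]; nlinarith
  have hN₀t : (N₀ : ℝ) ≤ t / 2 := by rw [ht, le_div_iff₀ (by positivity : (0:ℝ) < 2), div_eq_mul_inv]; nlinarith [inv_pos.2 hδ, mul_inv_cancel₀ hδ.ne']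
  -- the floors, sandwiched
  have e1 : (r / K + η + 2 * δ) / δ = q + e + 2 := by rw [hq, he]; field_simp
  have e2 : (K * r - η) / (2 * δ) = Kt / 2 - e / 2 := by rw [hKt, he]; field_simp
  have e3 : r / (2 * δ) = t / 2 := by rw [ht]; field_simp
  have e4 : K * r / (2 * δ) = Kt / 2 := by rw [hKt]; field_simp
  have e5 : (K * r - δ) / (2 * δ) = Kt / 2 - 1 / 2 := by rw [hKt]; field_simp
  have f1 : (⌊(r / K + η + 2 * δ) / δ⌋ : ℝ) ≤ q + e + 2 := (Int.floor_le _).trans_eq e1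
  have f1' : q + e + 2 < (⌊(r / K + η + 2 * δ) / δ⌋ : ℝ) + 1 := by rw [← e1]; exact Int.lt_floor_add_one _
  have f2 : (⌊(K * r - η) / (2 * δ)⌋ : ℝ) ≤ Kt / 2 - e / 2 := (Int.floor_le _).trans_eq e2
  have f2' : Kt / 2 - e / 2 < (⌊(K * r - η) / (2 * δ)⌋ : ℝ) + 1 := by rw [← e2]; exact Int.lt_floor_add_one _
  have f3 : (⌊r / (2 * δ)⌋ : ℝ) ≤ t / 2 := (Int.floor_le _).trans_eq e3
  have f3' : t / 2 < (⌊r / (2 * δ)⌋ : ℝ) + 1 := by rw [← e3]; exact Int.lt_floor_add_one _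
  have f4 : (⌊η / δ⌋ : ℝ) ≤ e := (Int.floor_le _).trans_eq he.symm
  have f4' : e < (⌊η / δ⌋ : ℝ) + 1 := by rw [he]; exact Int.lt_floor_add_one _
  have f5 : (⌊r / δ⌋ : ℝ) ≤ t := (Int.floor_le _).trans_eq ht.symm
  have f6 : (⌊K * r / (2 * δ)⌋ : ℝ) ≤ Kt / 2 := (Int.floor_le _).trans_eq e4
  have f6' : Kt / 2 < (⌊K * r / (2 * δ)⌋ : ℝ) + 1 := by rw [← e4]; exact Int.lt_floor_add_one _
  have f7 : (⌊(K * r - δ) / (2 * δ)⌋ : ℝ) ≤ Kt / 2 - 1 / 2 := (Int.floor_le _).trans_eq e5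
  have f7' : Kt / 2 - 1 / 2 < (⌊(K * r - δ) / (2 * δ)⌋ : ℝ) + 1 := by rw [← e5]; exact Int.lt_floor_add_one _
  have g1 : (0 : ℤ) ≤ ⌊(r / K + η + 2 * δ) / δ⌋ := Int.floor_nonneg.2 (by rw [e1]; linarith)
  have g4 : (0 : ℤ) ≤ ⌊η / δ⌋ := Int.floor_nonneg.2 (by rw [← he]; exact he0)
  refine ⟨by omega, ?_, ?_, g4, ?_, ?_, ?_, ?_, ?_, ?_, ?_, ?_⟩
  · have : ((2 * (⌊(r / K + η + 2 * δ) / δ⌋ + 3) + 6 : ℤ) : ℝ) ≤ ((⌊(K * r - η) / (2 * δ)⌋ - 4 : ℤ) : ℝ) := by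
      push_cast; linarith
    exact_mod_cast this
  · have : ((N₀ : ℤ) : ℝ) ≤ ((⌊r / (2 * δ)⌋ + (⌊(r / K + η + 2 * δ) / δ⌋ + 3) + 4 : ℤ) : ℝ) := by
      push_cast
      have : (0 : ℝ) ≤ ⌊(r / K + η + 2 * δ) / δ⌋ := by exact_mod_cast g1
      have hN : ((N₀ : ℤ) : ℝ) = (N₀ : ℝ) := by norm_cast
      linarith
    exact_mod_cast this
  · have : ((2 * (⌊η / δ⌋ + 2) + 2 : ℤ) : ℝ) ≤ ((⌊r / (2 * δ)⌋ + (⌊(r / K + η + 2 * δ) / δ⌋ + 3) + 4 : ℤ) : ℝ) := by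
      push_cast
      have : (0 : ℝ) ≤ ⌊(r / K + η + 2 * δ) / δ⌋ := by exact_mod_cast g1
      linarith
    exact_mod_cast this
  · have : ((4 * (⌊r / (2 * δ)⌋ + (⌊(r / K + η + 2 * δ) / δ⌋ + 3) + 4) + 2 * (⌊η / δ⌋ + 2) + 4 : ℤ) : ℝ) ≤
        ((⌊(K * r - η) / (2 * δ)⌋ - 4 - (⌊(r / K + η + 2 * δ) / δ⌋ + 3) - 2 : ℤ) : ℝ) := by
      push_cast; linarith
    exact_mod_cast this
  · have : ((⌊r / δ⌋ + 1 + (⌊(r / K + η + 2 * δ) / δ⌋ + 3) + 2 : ℤ) : ℝ) ≤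
        ((2 * (⌊r / (2 * δ)⌋ + (⌊(r / K + η + 2 * δ) / δ⌋ + 3) + 4) - 1 : ℤ) : ℝ) := by
      push_cast; linarith
    exact_mod_cast this
  · have : ((4 * (⌊r / (2 * δ)⌋ + (⌊(r / K + η + 2 * δ) / δ⌋ + 3) + 4) + (⌊η / δ⌋ + 2) + 3 : ℤ) : ℝ) ≤
        ((⌊K * r / (2 * δ)⌋ - 2 + 1 - (⌊(r / K + η + 2 * δ) / δ⌋ + 3) - 2 : ℤ) : ℝ) := by
      push_cast; linarith
    exact_mod_cast this
  · have : ((4 * (⌊r / (2 * δ)⌋ + (⌊(r / K + η + 2 * δ) / δ⌋ + 3) + 4) + 2 * (⌊η / δ⌋ + 2) + 2 : ℤ) : ℝ) ≤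
        ((⌊(K * r - δ) / (2 * δ)⌋ - 2 + 1 - (⌊(r / K + η + 2 * δ) / δ⌋ + 3) - 2 : ℤ) : ℝ) := by
      push_cast; linarith
    exact_mod_cast this
  · push_cast
    have hKr : K * r - η = δ * Kt - δ * e := by rw [hKt, he]; field_simp
    have hm := mul_le_mul_of_nonneg_left f2 hδ.le
    linarith [hm, hδ]
  · push_cast
    have hKr : K * r = δ * Kt := by rw [hKt]; field_simp
    have hm := mul_le_mul_of_nonneg_left f6 hδ.le
    linarith [hm, hδ]
  · push_cast
    have hKr : K * r - δ = δ * Kt - δ := by rw [hKt]; field_simp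
    have hm := mul_le_mul_of_nonneg_left f7 hδ.le
    linarith [hm, hδ]

/-- The midpoint of a translated edge is the translated midpoint. -/
theorem medialPoint_shift_JF (δ : ℝ) (u : Site 2) (e : Sym2 (Site 2)) :
    medialPoint δ (sym2Equiv (Site.shift u) e) = medialPoint δ e + meshPoint δ u := by
  induction e using Sym2.ind with
  | h x y =>
    rw [sym2Equiv_mk, Site.shift_apply, Site.shift_apply, medialPoint_mk, medialPoint_mk, meshPoint_add_shift,
      meshPoint_add_shift δ y u]
    ring

/-- In `Fin 4`: `-(1 - k) = k + 3` and `-(1 - k) + 1 = k`. -/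
theorem fin4_frame_index_JF (k : Fin 4) : -(1 - k) = k + 3 ∧ -(1 - k) + 1 = k := by
  revert k; decide

/-- Integer coordinates of a short vector: `|δ k| < η` gives `|k| ≤ ⌊η/δ⌋`. -/
theorem abs_le_floor_JF {δ η : ℝ} (hδ : 0 < δ) (k : ℤ) (hk : |δ * k| < η) : |k| ≤ ⌊η / δ⌋ := by
  rw [abs_lt] at hk
  have f := Int.lt_floor_add_one (η / δ)
  have e1 : (k : ℝ) < η / δ := by rw [lt_div_iff₀ hδ]; linarith
  have e2 : -(η / δ) < k := by rw [neg_lt, lt_div_iff₀ hδ]; linarith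
  have hk1 : k < ⌊η / δ⌋ + 1 := by
    have : (k : ℝ) < ((⌊η / δ⌋ + 1 : ℤ) : ℝ) := by push_cast; linarith
    exact_mod_cast this
  have hk2 : -(⌊η / δ⌋ + 1) < k := by
    have : ((-(⌊η / δ⌋ + 1) : ℤ) : ℝ) < k := by push_cast; linarith
    exact_mod_cast this
  rw [abs_le]; omega

/-- A rotation frame permutes the absolute values of the coordinates. -/
theorem frame_abs_JF {π : Equiv.Perm (Fin 2)} {ε : Fin 2 → ℤˣ} {j : Fin 4}
    (hrot : ∀ k, Site.signedPerm π ε (cornerUnit k) = cornerUnit (k + j)) (w : Site 2) :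
    (|Site.signedPerm π ε w 0| = |w 0| ∧ |Site.signedPerm π ε w 1| = |w 1|) ∨
      (|Site.signedPerm π ε w 0| = |w 1| ∧ |Site.signedPerm π ε w 1| = |w 0|) := by
  obtain ⟨h0, h1⟩ := frame_coord_JF hrot w
  rw [h0, h1]
  rcases corner_coord_JF j with hc | hc | hc | hc <;>
    simp only [hc.1, hc.2.1, hc.2.2.1, hc.2.2.2.1, mul_one, mul_zero, mul_neg, add_zero, zero_add, abs_neg] <;> simp

end

end Summit.CriticalPhenomena.CardyFormulaZ2.Cruxes.EdgePrecompact.QkzStripBoundaryArm
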